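/-
Copyright (c) 2026 the pub-hodgecm-mathlib formalisation cell (harness21).  Prover seat hodgecm-mathlib-K2Liu-p02 (g7), Track B «K2-LIT» ∕ hLiu418
#184♮, socket #42F′ TOP (U5 lineage; LEAD F0P6-plan (g14) BATCH #39 (2): the COINVARIANCE adapter — the GLOBAL carrier of the `U(V′)(𝔸)`-action its
instance inputs (F1)∕(F3) are about).  DEFINITION LANE (`--supports stmt-HodgeConjecture-24832 --as helper`): ONE definition with body (`partnerEmb`) + its API;
no `instance`, no notation, no named-fact hypothesis, no `sorry`.
-/
import Literature.NumberTheory.K2Lit.DoubledTensorEmbedding          -- ★ O42.3b-emb: `tensorEmb`, `epsD`, `epsV`, `epsD_symm_inl∕inr`, `adelicForm_hermD_tensor` (+ GR `HA`, `blk`, `IsSiegelDelta`, `deltaBlock`)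
import Literature.NumberTheory.Automorphic.UnitaryGroupDualPairCarriers   -- ★ `adelicInr`, `coe_adelicInr`, `commute_adelicInl_adelicInr`, `continuous_adelicInr`
import HarnessLib

/-!
# Crux `HLiu418`, Road I (#42F′ by uniqueness), U5 TOP: THE GLOBAL PARTNER EMBEDDING `U(V′)(𝔸) →* U(𝔻 ⊗ V′)(𝔸)`, `k ↦ 1_𝔻 ⊗ k`, IS SIEGEL AND
# COMMUTES WITH `tensorEmb` (so ★ (F1) applies to it — sequel `K2LiuPartnerEmbeddingSWLaw`)

Cell `hodgecm-mathlib`, crux item hLiu418 = `stmt-HodgeConjecture-24832`; squad K2 ∕ K2Liu, prover K2Liu-p02 (g7); count-neutral helper.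
Namespace `Summit.HodgeConjecture.HodgeConjecture.Cruxes.HLiu418.K2LiuPartnerEmbedding`.

THE POINT (K2Liu-p02 (g7) coinvariance census (F1)∕(F3); ★ (Avg) p859937 took this carrier hypothesis-first as `jf`; ★ I-1a∕I-1b `oneKronInr`∕`partnerEmbLoc` are its
LOCAL twins).  The second member of the see-saw dual pair `U(𝔻) × U(V′) → U(𝔻 ⊗ V′)`, GLOBALLY over the adeles, typed exactly like ★ O42.3b-emb `tensorEmb`
(`h ↦ h ⊗ 1_{V′}` = ★ `adelicInl` + ★ `reindexU epsD` + the cast along ★ `adelicForm_hermD_tensor`) with ★ `adelicInr` (`k ↦ 1 ⊗ k`) in place of `adelicInl`: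
* §1 **`partnerEmb : U(diag dV′)(𝔸) →* U(𝔻 ⊗ V′)(𝔸)`**, `coe_partnerEmb` (`= reindex epsD (1_{n+n} ⊗ₖ k)`, `rfl`), `continuous_partnerEmb`, and
  **`commute_tensorEmb_partnerEmb`**: `(h ⊗ 1)(1 ⊗ k) = (1 ⊗ k)(h ⊗ 1)` (★ `commute_adelicInl_adelicInr` pushed through the common homomorphism);
* §2 its blocks in the `Δ′`-enumeration: `1 ⊗ k` is BLOCK-DIAGONAL with both diagonal blocks `reindex epsV (1_n ⊗ₖ k)` (`blk_partnerEmb_toBlocks₁₁∕₁₂∕₂₁∕₂₂`,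
  the index chase of ★ `blk_tensorEmb_toBlocks··` with ★ `epsD_symm_inl∕inr`), hence **`isSiegelDelta_partnerEmb`** (`1 ⊗ k ∈ P_{Δ′}(𝔸)`: it is the diagonal
  doubling `ι(g, g)` of `g = 1_𝕍 ⊗ k ∈ U(𝕍 ⊗ V′)`) and `deltaBlock_partnerEmb` (`(1 ⊗ k)|_{Δ′} = reindex epsV (1_n ⊗ₖ k)`);
* (sequel, theorems file `K2LiuPartnerEmbeddingSWLaw`): ★ (F1) `K2LiuSiegelWeilTensorPartnerLaw.swSectionTensor_omega_eq_smul` AT `q := partnerEmb k` — the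
  hypothesis-free `(U(V′)(𝔸), χ′)`-semi-invariance of the Siegel–Weil section of the `M₂`-frame and of #42F′'s twisted standard family.
[Kudla1994, §2 (doubled space, Siegel parabolic), §3 Thm. 3.1; HarrisKudlaSweet1996, §1 (1.8), (1.15)–(1.17); MoeglinVignerasWaldspurger1987, Ch. 1 I.17.]

HONEST LABEL.  Count-neutral helper: `HC_CM` is proved only modulo the 7 printed citations (2 remaining named inputs: hLiu418 = `stmt-HodgeConjecture-24832`,
h413 = `stmt-HodgeConjecture-24833`) until rung 0 closes; closes no socket by itself.
-/

set_option autoImplicit false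
set_option linter.dupNamespace false -- the mandated namespace repeats `HodgeConjecture.HodgeConjecture`

noncomputable section

open NumberField IsDedekindDomain
open scoped Matrix Kronecker

namespace Summit.HodgeConjecture.HodgeConjecture.Cruxes.HLiu418.K2LiuPartnerEmbedding

open Literature.NumberTheory.Automorphic Literature.NumberTheory.Automorphic.UnitaryGroup Literature.NumberTheory.GaloisRepresentations
open Literature.NumberTheory.GelbartRogawski1991 Literature.NumberTheory.GelbartRogawski1991.GRConstruction
open Literature.NumberTheory.K2Lit.SiegelDoubled

variable (L : Type) [Field L] [NumberField L] [IsCMField L]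
variable {N M n : ℕ} (e : Fin N × Fin M ≃ Fin n)
  (dV : Fin N → L) (hdV : ∀ i, IsCMField.complexConj L (dV i) = dV i)
  (dW : Fin M → L) (hdW : ∀ i, IsCMField.complexConj L (dW i) = dW i)
variable {M₂ M' n' : ℕ} (eW : Fin M × Fin M₂ ≃ Fin M') (e' : Fin N × Fin M' ≃ Fin n')
  (dV' : Fin M₂ → L) (hdV' : ∀ k, IsCMField.complexConj L (dV' k) = dV' k)

/-! ## §1 The embedding `k ↦ 1_𝔻 ⊗ k` -/

/-- **`partnerEmb : U(V′)(𝔸) →* U(𝔻 ⊗ V′)(𝔸)`, `k ↦ reindex epsD (1_{n+n} ⊗ₖ k)`** — the second member of the see-saw dual pair `U(𝔻) × U(V′) → U(𝔻 ⊗ V′)`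
over the adeles (★ `adelicInr`, ★ `reindexU`, cast along ★ `adelicForm_hermD_tensor`; the twin of ★ `tensorEmb`).
[cite: Kudla1994, §2 (doubled space, Siegel parabolic)] [cite: HarrisKudlaSweet1996, §1 (1.8)] -/
def partnerEmb : UnitaryGroup.adelic (Fp L) L (IsCMField.complexConj L) M₂ (Matrix.diagonal dV') →*
    HA L e' dV hdV (tensorFrame L dW eW dV') (tensorFrame_real L dW hdW eW dV' hdV') :=
  (Subgroup.inclusion (le_of_eq (congrArg (unitaryGroupOfForm (UnitaryGroup.conjAdele (Fp L) L (IsCMField.complexConj L)))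
      (adelicForm_hermD_tensor L e dV hdV dW hdW eW e' dV' hdV').symm))).comp <|
    (UnitaryGroup.reindexU _ (epsD e eW e') _).comp
      (UnitaryGroup.adelicInr (Fp L) L (IsCMField.complexConj L) (n + n) M₂ (hermD L e dV hdV dW hdW) (Matrix.diagonal dV'))

/-- the matrix of `partnerEmb k` is `reindex epsD (1 ⊗ₖ k)`. [cite: Kudla1994, §2 (doubled space, Siegel parabolic)] -/
theorem coe_partnerEmb (k : UnitaryGroup.adelic (Fp L) L (IsCMField.complexConj L) M₂ (Matrix.diagonal dV')) :
    (((partnerEmb L e dV hdV dW hdW eW e' dV' hdV' k : HA L e' dV hdV (tensorFrame L dW eW dV') (tensorFrame_real L dW hdW eW dV' hdV')) :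
        GL (Fin (n' + n')) (AdeleRing (𝓞 L) L)) : Matrix (Fin (n' + n')) (Fin (n' + n')) (AdeleRing (𝓞 L) L)) =
      Matrix.reindex (epsD e eW e') (epsD e eW e')
        ((1 : Matrix (Fin (n + n)) (Fin (n + n)) (AdeleRing (𝓞 L) L)) ⊗ₖ
          (((k : UnitaryGroup.adelic (Fp L) L (IsCMField.complexConj L) M₂ (Matrix.diagonal dV')) : GL (Fin M₂) (AdeleRing (𝓞 L) L)) :
            Matrix (Fin M₂) (Fin M₂) (AdeleRing (𝓞 L) L))) := by
  rfl

/-- `partnerEmb` in `GL`: `reindexGL epsD (1 ⊗ k)`. [cite: Kudla1994, §2 (doubled space, Siegel parabolic)] -/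
theorem coe_partnerEmb_GL (k : UnitaryGroup.adelic (Fp L) L (IsCMField.complexConj L) M₂ (Matrix.diagonal dV')) :
    ((partnerEmb L e dV hdV dW hdW eW e' dV' hdV' k : HA L e' dV hdV (tensorFrame L dW eW dV') (tensorFrame_real L dW hdW eW dV' hdV')) :
        GL (Fin (n' + n')) (AdeleRing (𝓞 L) L)) =
      UnitaryGroup.reindexGL (epsD e eW e')
        ((UnitaryGroup.adelicInr (Fp L) L (IsCMField.complexConj L) (n + n) M₂ (hermD L e dV hdV dW hdW) (Matrix.diagonal dV') k :
          UnitaryGroup.adelicPair (Fp L) L (IsCMField.complexConj L) (n + n) M₂ (hermD L e dV hdV dW hdW) (Matrix.diagonal dV')) :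
            GL (Fin (n + n) × Fin M₂) (AdeleRing (𝓞 L) L)) := rfl

/-- `partnerEmb` is continuous. [cite: Kudla1994, §2 (doubled space, Siegel parabolic)] -/
theorem continuous_partnerEmb : Continuous (partnerEmb L e dV hdV dW hdW eW e' dV' hdV') := by
  refine continuous_induced_rng.2 ?_
  rw [show ((↑) : HA L e' dV hdV (tensorFrame L dW eW dV') (tensorFrame_real L dW hdW eW dV' hdV') → GL (Fin (n' + n')) (AdeleRing (𝓞 L) L)) ∘
      ⇑(partnerEmb L e dV hdV dW hdW eW e' dV' hdV') = fun k => UnitaryGroup.reindexGL (epsD e eW e')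
        ((UnitaryGroup.adelicInr (Fp L) L (IsCMField.complexConj L) (n + n) M₂ (hermD L e dV hdV dW hdW) (Matrix.diagonal dV') k :
          UnitaryGroup.adelicPair (Fp L) L (IsCMField.complexConj L) (n + n) M₂ (hermD L e dV hdV dW hdW) (Matrix.diagonal dV')) :
            GL (Fin (n + n) × Fin M₂) (AdeleRing (𝓞 L) L)) from funext fun k => coe_partnerEmb_GL L e dV hdV dW hdW eW e' dV' hdV' k]
  exact (UnitaryGroup.continuous_reindexGL _).comp (continuous_subtype_val.comp
    (UnitaryGroup.continuous_adelicInr (Fp L) L (IsCMField.complexConj L) (n + n) M₂ (hermD L e dV hdV dW hdW) (Matrix.diagonal dV')))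

/-- **THE TWO MEMBERS OF THE DUAL PAIR COMMUTE**: `(h ⊗ 1)(1 ⊗ k) = (1 ⊗ k)(h ⊗ 1)` in `U(𝔻 ⊗ V′)(𝔸)` (★ `commute_adelicInl_adelicInr` through the common
homomorphism `reindexU epsD` + cast). [cite: MoeglinVignerasWaldspurger1987, Ch. 1 I.17] [cite: Kudla1994, §2 (doubled space, Siegel parabolic)] -/
theorem commute_tensorEmb_partnerEmb (h : HA L e dV hdV dW hdW) (k : UnitaryGroup.adelic (Fp L) L (IsCMField.complexConj L) M₂ (Matrix.diagonal dV')) :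
    tensorEmb L e dV hdV dW hdW eW e' dV' hdV' h * partnerEmb L e dV hdV dW hdW eW e' dV' hdV' k =
      partnerEmb L e dV hdV dW hdW eW e' dV' hdV' k * tensorEmb L e dV hdV dW hdW eW e' dV' hdV' h :=
  ((UnitaryGroup.commute_adelicInl_adelicInr (Fp L) L (IsCMField.complexConj L) (n + n) M₂ (hermD L e dV hdV dW hdW) (Matrix.diagonal dV') h k).map
    ((Subgroup.inclusion (le_of_eq (congrArg (unitaryGroupOfForm (UnitaryGroup.conjAdele (Fp L) L (IsCMField.complexConj L)))
        (adelicForm_hermD_tensor L e dV hdV dW hdW eW e' dV' hdV').symm))).comp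
      (UnitaryGroup.reindexU _ (epsD e eW e') _))).eq

/-! ## §2 `1 ⊗ k` is block-diagonal in the `Δ′`-enumeration, hence Siegel -/

/-- the `(1,1)` block of `1 ⊗ k` is `reindex epsV (1_n ⊗ₖ k)`. [cite: Kudla1994, §2 (doubled space, Siegel parabolic)] -/
theorem blk_partnerEmb_toBlocks₁₁ (k : UnitaryGroup.adelic (Fp L) L (IsCMField.complexConj L) M₂ (Matrix.diagonal dV')) :
    (blk L e' dV hdV (tensorFrame L dW eW dV') (tensorFrame_real L dW hdW eW dV' hdV') (partnerEmb L e dV hdV dW hdW eW e' dV' hdV' k)).toBlocks₁₁ =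
      Matrix.reindex (epsV e eW e') (epsV e eW e')
        ((1 : Matrix (Fin n) (Fin n) (AdeleRing (𝓞 L) L)) ⊗ₖ
          (((k : UnitaryGroup.adelic (Fp L) L (IsCMField.complexConj L) M₂ (Matrix.diagonal dV')) : GL (Fin M₂) (AdeleRing (𝓞 L) L)) :
            Matrix (Fin M₂) (Fin M₂) (AdeleRing (𝓞 L) L))) := by
  ext u v
  obtain ⟨⟨x, i⟩, rfl⟩ := (epsV e eW e').surjective u
  obtain ⟨⟨y, j⟩, rfl⟩ := (epsV e eW e').surjective v
  simp only [blk, Matrix.toBlocks₁₁, Matrix.reindex_apply, Matrix.submatrix_apply, Matrix.of_apply, Equiv.symm_symm,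
    Equiv.symm_apply_apply, coe_partnerEmb, epsD_symm_inl, Matrix.kroneckerMap_apply, Matrix.one_apply,
    EmbeddingLike.apply_eq_iff_eq, Sum.inl.injEq]

/-- the `(1,2)` block of `1 ⊗ k` vanishes. [cite: Kudla1994, §2 (doubled space, Siegel parabolic)] -/
theorem blk_partnerEmb_toBlocks₁₂ (k : UnitaryGroup.adelic (Fp L) L (IsCMField.complexConj L) M₂ (Matrix.diagonal dV')) :
    (blk L e' dV hdV (tensorFrame L dW eW dV') (tensorFrame_real L dW hdW eW dV' hdV') (partnerEmb L e dV hdV dW hdW eW e' dV' hdV' k)).toBlocks₁₂ = 0 := by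
  ext u v
  obtain ⟨⟨x, i⟩, rfl⟩ := (epsV e eW e').surjective u
  obtain ⟨⟨y, j⟩, rfl⟩ := (epsV e eW e').surjective v
  simp only [blk, Matrix.toBlocks₁₂, Matrix.reindex_apply, Matrix.submatrix_apply, Matrix.of_apply, Equiv.symm_symm,
    coe_partnerEmb, epsD_symm_inl, epsD_symm_inr, Matrix.kroneckerMap_apply, Matrix.one_apply,
    EmbeddingLike.apply_eq_iff_eq, reduceCtorEq, if_false, zero_mul, Matrix.zero_apply]

/-- the `(2,1)` block of `1 ⊗ k` vanishes. [cite: Kudla1994, §2 (doubled space, Siegel parabolic)] -/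
theorem blk_partnerEmb_toBlocks₂₁ (k : UnitaryGroup.adelic (Fp L) L (IsCMField.complexConj L) M₂ (Matrix.diagonal dV')) :
    (blk L e' dV hdV (tensorFrame L dW eW dV') (tensorFrame_real L dW hdW eW dV' hdV') (partnerEmb L e dV hdV dW hdW eW e' dV' hdV' k)).toBlocks₂₁ = 0 := by
  ext u v
  obtain ⟨⟨x, i⟩, rfl⟩ := (epsV e eW e').surjective u
  obtain ⟨⟨y, j⟩, rfl⟩ := (epsV e eW e').surjective v
  simp only [blk, Matrix.toBlocks₂₁, Matrix.reindex_apply, Matrix.submatrix_apply, Matrix.of_apply, Equiv.symm_symm,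
    coe_partnerEmb, epsD_symm_inl, epsD_symm_inr, Matrix.kroneckerMap_apply, Matrix.one_apply,
    EmbeddingLike.apply_eq_iff_eq, reduceCtorEq, if_false, zero_mul, Matrix.zero_apply]

/-- the `(2,2)` block of `1 ⊗ k` is `reindex epsV (1_n ⊗ₖ k)`. [cite: Kudla1994, §2 (doubled space, Siegel parabolic)] -/
theorem blk_partnerEmb_toBlocks₂₂ (k : UnitaryGroup.adelic (Fp L) L (IsCMField.complexConj L) M₂ (Matrix.diagonal dV')) :
    (blk L e' dV hdV (tensorFrame L dW eW dV') (tensorFrame_real L dW hdW eW dV' hdV') (partnerEmb L e dV hdV dW hdW eW e' dV' hdV' k)).toBlocks₂₂ =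
      Matrix.reindex (epsV e eW e') (epsV e eW e')
        ((1 : Matrix (Fin n) (Fin n) (AdeleRing (𝓞 L) L)) ⊗ₖ
          (((k : UnitaryGroup.adelic (Fp L) L (IsCMField.complexConj L) M₂ (Matrix.diagonal dV')) : GL (Fin M₂) (AdeleRing (𝓞 L) L)) :
            Matrix (Fin M₂) (Fin M₂) (AdeleRing (𝓞 L) L))) := by
  ext u v
  obtain ⟨⟨x, i⟩, rfl⟩ := (epsV e eW e').surjective u
  obtain ⟨⟨y, j⟩, rfl⟩ := (epsV e eW e').surjective v
  simp only [blk, Matrix.toBlocks₂₂, Matrix.reindex_apply, Matrix.submatrix_apply, Matrix.of_apply, Equiv.symm_symm,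
    Equiv.symm_apply_apply, coe_partnerEmb, epsD_symm_inr, Matrix.kroneckerMap_apply, Matrix.one_apply,
    EmbeddingLike.apply_eq_iff_eq, Sum.inr.injEq]

/-- **`1 ⊗ k ∈ P_{Δ′}(𝔸)`**: block-diagonal with equal diagonal blocks, `1 ⊗ k` stabilises the diagonal `Δ′` (it is the diagonal doubling of
`1_𝕍 ⊗ k ∈ U(𝕍 ⊗ V′)`). [cite: Kudla1994, §2 (doubled space, Siegel parabolic)] [cite: HarrisKudlaSweet1996, §1 (1.11)–(1.12)] -/
theorem isSiegelDelta_partnerEmb (k : UnitaryGroup.adelic (Fp L) L (IsCMField.complexConj L) M₂ (Matrix.diagonal dV')) :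
    IsSiegelDelta L e' dV hdV (tensorFrame L dW eW dV') (tensorFrame_real L dW hdW eW dV' hdV') (partnerEmb L e dV hdV dW hdW eW e' dV' hdV' k) := by
  unfold IsSiegelDelta
  rw [blk_partnerEmb_toBlocks₁₁, blk_partnerEmb_toBlocks₁₂, blk_partnerEmb_toBlocks₂₁, blk_partnerEmb_toBlocks₂₂, add_zero, zero_add]

/-- **`(1 ⊗ k)|_{Δ′} = reindex epsV (1_n ⊗ₖ k)`**. [cite: Kudla1994, §2 (doubled space, Siegel parabolic)] -/
theorem deltaBlock_partnerEmb (k : UnitaryGroup.adelic (Fp L) L (IsCMField.complexConj L) M₂ (Matrix.diagonal dV')) :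
    deltaBlock L e' dV hdV (tensorFrame L dW eW dV') (tensorFrame_real L dW hdW eW dV' hdV') (partnerEmb L e dV hdV dW hdW eW e' dV' hdV' k) =
      Matrix.reindex (epsV e eW e') (epsV e eW e')
        ((1 : Matrix (Fin n) (Fin n) (AdeleRing (𝓞 L) L)) ⊗ₖ
          (((k : UnitaryGroup.adelic (Fp L) L (IsCMField.complexConj L) M₂ (Matrix.diagonal dV')) : GL (Fin M₂) (AdeleRing (𝓞 L) L)) :
            Matrix (Fin M₂) (Fin M₂) (AdeleRing (𝓞 L) L))) := by
  rw [deltaBlock, blk_partnerEmb_toBlocks₁₁, blk_partnerEmb_toBlocks₁₂, add_zero]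

end Summit.HodgeConjecture.HodgeConjecture.Cruxes.HLiu418.K2LiuPartnerEmbedding

end
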